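import Literature.Probability.RandomPlanarGeometry.HexSAWSurfaceFourthOrderLower
import HarnessLib

/-!
# Honeycomb SAW at the Duminil-Copin–Smirnov surface (brick-wall frame): the FIVE-seed renewal and the FIFTH-order term of the adsorbed-phase
# free energy from below — `β(y)² ≥ y + y/β⁴ + y/β⁶ + 3y/β⁸ + y²/β¹⁰ + 9y²/β¹²`, hence, under an `O(y⁻⁴)` upper window,
# `liminf_{y→∞} y⁴ (β(y)² − y − 1/y − 1/y² − 2/y³) ≥ 4`

Topic `Literature/Probability/RandomPlanarGeometry` (lane «pcv-sawmu», car «WALL-FIFTH-ORDER-LOWER», a-p6 g16).  Continues the same seat's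
`HexSAWSurfaceFourthOrderLower.lean` (direct concatenation of LEFT-PROPER seeds `dcat_spec`, the table walks `Tab.walk`, the seeds of length six,
eight and ten, the four-seed renewal `WB_four_seed_rec`) by one more family: the NINE one-visit wall bridges of length twelve, glued behind a
two-step junction (left-properness is then irrelevant; at fifth order the junction costs nothing, because a seed of length twelve already weighs
`y⁻⁴` relative to the straight wall and the junction factor `y/β² = 1 − O(y⁻²)`).

Sources.  E. J. Janse van Rensburg (OUP 2000), §3.1.1 (Assumptions 3.1(3), eqn (3.1)) and §3.3.2, Lemma 3.20; Hammersley–Torrie–Whittington,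
J. Phys. A 15 (1982) 539, §2 (locator provisional, source not held); Madras–Slade (1993), §1.2 ((1.2.15)–(1.2.17)); BBdGDCG, CMP 326 (2014) =
arXiv:1109.0358v5, §3.1, Proposition 5 (p. 9), p. 10; Enting–Jensen, LNP 775 (2009), §7.4.2, Fig. 7.10.

## What is proved (namespace `…SAW.HexBW.Wall`)

* §1 `Tab.Facts₀` / `Tab.walk_components₀` (table walks without the left-properness clause); §2 the nine seeds of length twelve
  (`Twelve.W : Fin 9 → ℕ → Site 2`, facts and one visit each by `decide`, an injective three-time abscissa code), ★ `nine_le_wbrN_twelve_one`.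
* §3 ★★ **`WB_five_seed_rec : y B^w_{n+12} + ℓ₆ y B^w_{n+8} + ℓ₈ y B^w_{n+6} + ℓ₁₀ y B^w_{n+4} + y² B^w_{n+2} + h₁₂ y² B^w_n ≤ B^w_{n+14}`**
  (`h₁₂ = wbrN 12 1`) — SIX pairwise disjoint injections.
* §4 subsolutions, ★★ `five_seed_le_wallRate_pow_fourteen`, ★★ `add_five_seed_div_le_sq_wallRate :
  y + y/β⁴ + y/β⁶ + 3y/β⁸ + y²/β¹⁰ + 9y²/β¹² ≤ β²`.
* §5 ★★★ **`fifth_window_lower (0 < y) (0 ≤ C) (β² ≤ y + 1/y + 1/y² + 2/y³ + C/y⁴) :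
  y + 1/y + 1/y² + 2/y³ + 4/y⁴ − 24/y⁵ − (77+2C)/y⁶ − (88+3C)/y⁷ − (108+17C)/y⁸ − 54C/y⁹ ≤ β²`**, and the `y ≥ 1` coarse form
  `fifth_window_lower' : … + 4/y⁴ − (297 + 76C)/y⁵ ≤ β²`; `four_sub_div_le_of_window` (`4 − (297+76C)/y ≤ y⁴(β² − y − 1/y − 1/y² − 2/y³)`).
  (The unconditional forms follow with the companion «WALL-FOURTH-ORDER-UPPER»'s `C = 708591`, `y ≥ 36`; assembled in the EXACT car.)

HONEST LABEL.  LANE LEMMAS/THEOREM S; the fifth coefficient `≥ 4` (modulo an `O(y⁻⁴)` upper window, which the companion supplies) is NEW IN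
WRITING (modest) in the same sense as the companions; the census conjecture says `= 4`.  NOT CLAIMED: `h₁₂ = 9`, the matching upper bound.

EDITION 2 (a-p6 g16, 03:17Z): ref g60 token FL-1 — the l.169 locator is given unquoted, as in the tree's `HexSAWSurfaceDensityFunction`; code unchanged.
-/

noncomputable section

open Finset Filter Function
open Literature.Probability.LatticeModels Literature.Probability.Percolation SimpleGraph
open _root_.Topology

namespace Literature.Probability.RandomPlanarGeometry.SAW.HexBW.Wall

variable {y : ℝ} {n m : ℕ} {ω υ : ℕ → Site 2}

/-! ### §1  Table walks without left-properness -/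

namespace Tab

variable {L : ℕ} {X Y : ℕ → ℤ}

/-- The decidable coordinate facts making `walk L X Y` a wall bridge of (even) length `L` (no left-properness).
[cite: EntingJensen2009, §7.4.2, Fig. 7.10; MadrasSlade1993, §1.2, Definition 1.2.1 (bridges)] -/
def Facts₀ (L : ℕ) (X Y : ℕ → ℤ) : Prop :=
  (∀ i < L, Eight.adjE (X i) (Y i) (X (i + 1)) (Y (i + 1)) = true) ∧
    (∀ i ≤ L, ∀ j ≤ L, X i = X j → Y i = Y j → i = j) ∧ (∀ i ≤ L, Y i ≤ 0) ∧
    (∀ i ≤ L, X 0 ≤ X i ∧ X i ≤ X L) ∧ X 0 = 0 ∧ Y 0 = 0 ∧ Y L = 0 ∧ L % 2 = 0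

/-- Membership components of a table walk satisfying `Facts₀` (`∀`/`∧`/`=` form). [cite: MadrasSlade1993, §1.2, Definition 1.2.1 (bridges); EntingJensen2009, §7.4.2, Fig. 7.10] -/
theorem walk_components₀ (h : Facts₀ L X Y) :
    walk L X Y 0 = 0 ∧ (∀ i, L ≤ i → walk L X Y i = walk L X Y L) ∧ IsBW L (walk L X Y) ∧
      Set.InjOn (walk L X Y) {i | i ≤ L} ∧ InHP L (walk L X Y) ∧ IsArch L (walk L X Y) ∧ IsWB L (walk L X Y) := by
  obtain ⟨hadj, hinj, hY, hmono, hX0, hY0, hYL, hL2⟩ := h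
  refine ⟨?_, fun i hi => by simp only [walk, min_eq_right hi, min_self], fun i hi => ?_, fun i hi j hj hij => ?_, fun i hi => ?_,
    ⟨hL2, ?_⟩, fun i hi => ?_⟩
  · rw [site_two_eq_iff]; simp only [walk, Nat.zero_min, Arm.pt_apply_zero, Arm.pt_apply_one, hX0, hY0]; exact ⟨rfl, rfl⟩
  · simp only [walk, min_eq_left hi.le, min_eq_left (Nat.succ_le_of_lt hi)]; exact Eight.adj_of_adjE (hadj i hi)
  · simp only [Set.mem_setOf_eq] at hi hj
    have e0 := congrFun hij 0
    have e1 := congrFun hij 1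
    simp only [walk, Arm.pt_apply_zero, Arm.pt_apply_one, min_eq_left hi, min_eq_left hj] at e0 e1
    exact hinj i hi j hj e0 e1
  · simp only [walk, Arm.pt_apply_one, min_eq_left hi]; exact hY i hi
  · simp only [walk, Arm.pt_apply_one, min_self]; exact hYL
  · simp only [walk, Arm.pt_apply_zero, Nat.zero_min, min_self, min_eq_left hi]; exact hmono i hi

end Tab

/-! ### §2  The nine one-visit seeds of length twelve -/

namespace Twelve

/-- `X`-table of the one-visit seed of length twelve no. 0. [cite: EntingJensen2009, §7.4.2, Fig. 7.10] -/
def x0 : ℕ → ℤ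
  | 0 => 0 | 1 => 1 | 2 => 1 | 3 => 2 | 4 => 3 | 5 => 4 | 6 => 5 | 7 => 6 | 8 => 7 | 9 => 8 | 10 => 9 | 11 => 9 | _ => 10

/-- `Y`-table of the one-visit seed of length twelve no. 0. [cite: EntingJensen2009, §7.4.2, Fig. 7.10] -/
def y0 : ℕ → ℤ
  | 0 => 0 | 1 => 0 | 2 => -1 | 3 => -1 | 4 => -1 | 5 => -1 | 6 => -1 | 7 => -1 | 8 => -1 | 9 => -1 | 10 => -1 | 11 => 0 | _ => 0

/-- `X`-table of the one-visit seed of length twelve no. 1. [cite: EntingJensen2009, §7.4.2, Fig. 7.10] -/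
def x1 : ℕ → ℤ
  | 0 => 0 | 1 => 1 | 2 => 1 | 3 => 2 | 4 => 3 | 5 => 4 | 6 => 4 | 7 => 5 | 8 => 6 | 9 => 6 | 10 => 7 | 11 => 7 | _ => 8

/-- `Y`-table of the one-visit seed of length twelve no. 1. [cite: EntingJensen2009, §7.4.2, Fig. 7.10] -/
def y1 : ℕ → ℤ
  | 0 => 0 | 1 => 0 | 2 => -1 | 3 => -1 | 4 => -1 | 5 => -1 | 6 => -2 | 7 => -2 | 8 => -2 | 9 => -1 | 10 => -1 | 11 => 0 | _ => 0

/-- `X`-table of the one-visit seed of length twelve no. 2. [cite: EntingJensen2009, §7.4.2, Fig. 7.10] -/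
def x2 : ℕ → ℤ
  | 0 => 0 | 1 => 1 | 2 => 1 | 3 => 2 | 4 => 3 | 5 => 4 | 6 => 4 | 7 => 5 | 8 => 6 | 9 => 6 | 10 => 5 | 11 => 5 | _ => 6

/-- `Y`-table of the one-visit seed of length twelve no. 2. [cite: EntingJensen2009, §7.4.2, Fig. 7.10] -/
def y2 : ℕ → ℤ
  | 0 => 0 | 1 => 0 | 2 => -1 | 3 => -1 | 4 => -1 | 5 => -1 | 6 => -2 | 7 => -2 | 8 => -2 | 9 => -1 | 10 => -1 | 11 => 0 | _ => 0

/-- `X`-table of the one-visit seed of length twelve no. 3. [cite: EntingJensen2009, §7.4.2, Fig. 7.10] -/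
def x3 : ℕ → ℤ
  | 0 => 0 | 1 => 1 | 2 => 1 | 3 => 2 | 4 => 2 | 5 => 3 | 6 => 4 | 7 => 5 | 8 => 6 | 9 => 6 | 10 => 7 | 11 => 7 | _ => 8

/-- `Y`-table of the one-visit seed of length twelve no. 3. [cite: EntingJensen2009, §7.4.2, Fig. 7.10] -/
def y3 : ℕ → ℤ
  | 0 => 0 | 1 => 0 | 2 => -1 | 3 => -1 | 4 => -2 | 5 => -2 | 6 => -2 | 7 => -2 | 8 => -2 | 9 => -1 | 10 => -1 | 11 => 0 | _ => 0

/-- `X`-table of the one-visit seed of length twelve no. 4. [cite: EntingJensen2009, §7.4.2, Fig. 7.10] -/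
def x4 : ℕ → ℤ
  | 0 => 0 | 1 => 1 | 2 => 1 | 3 => 2 | 4 => 2 | 5 => 3 | 6 => 4 | 7 => 5 | 8 => 6 | 9 => 6 | 10 => 5 | 11 => 5 | _ => 6

/-- `Y`-table of the one-visit seed of length twelve no. 4. [cite: EntingJensen2009, §7.4.2, Fig. 7.10] -/
def y4 : ℕ → ℤ
  | 0 => 0 | 1 => 0 | 2 => -1 | 3 => -1 | 4 => -2 | 5 => -2 | 6 => -2 | 7 => -2 | 8 => -2 | 9 => -1 | 10 => -1 | 11 => 0 | _ => 0

/-- `X`-table of the one-visit seed of length twelve no. 5. [cite: EntingJensen2009, §7.4.2, Fig. 7.10] -/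
def x5 : ℕ → ℤ
  | 0 => 0 | 1 => 1 | 2 => 1 | 3 => 2 | 4 => 2 | 5 => 3 | 6 => 4 | 7 => 4 | 8 => 5 | 9 => 6 | 10 => 7 | 11 => 7 | _ => 8

/-- `Y`-table of the one-visit seed of length twelve no. 5. [cite: EntingJensen2009, §7.4.2, Fig. 7.10] -/
def y5 : ℕ → ℤ
  | 0 => 0 | 1 => 0 | 2 => -1 | 3 => -1 | 4 => -2 | 5 => -2 | 6 => -2 | 7 => -1 | 8 => -1 | 9 => -1 | 10 => -1 | 11 => 0 | _ => 0

/-- `X`-table of the one-visit seed of length twelve no. 6. [cite: EntingJensen2009, §7.4.2, Fig. 7.10] -/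
def x6 : ℕ → ℤ
  | 0 => 0 | 1 => 1 | 2 => 1 | 3 => 0 | 4 => 0 | 5 => 1 | 6 => 2 | 7 => 3 | 8 => 4 | 9 => 4 | 10 => 5 | 11 => 5 | _ => 6

/-- `Y`-table of the one-visit seed of length twelve no. 6. [cite: EntingJensen2009, §7.4.2, Fig. 7.10] -/
def y6 : ℕ → ℤ
  | 0 => 0 | 1 => 0 | 2 => -1 | 3 => -1 | 4 => -2 | 5 => -2 | 6 => -2 | 7 => -2 | 8 => -2 | 9 => -1 | 10 => -1 | 11 => 0 | _ => 0

/-- `X`-table of the one-visit seed of length twelve no. 7. [cite: EntingJensen2009, §7.4.2, Fig. 7.10] -/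
def x7 : ℕ → ℤ
  | 0 => 0 | 1 => 1 | 2 => 1 | 3 => 0 | 4 => 0 | 5 => 1 | 6 => 2 | 7 => 3 | 8 => 4 | 9 => 4 | 10 => 3 | 11 => 3 | _ => 4

/-- `Y`-table of the one-visit seed of length twelve no. 7. [cite: EntingJensen2009, §7.4.2, Fig. 7.10] -/
def y7 : ℕ → ℤ
  | 0 => 0 | 1 => 0 | 2 => -1 | 3 => -1 | 4 => -2 | 5 => -2 | 6 => -2 | 7 => -2 | 8 => -2 | 9 => -1 | 10 => -1 | 11 => 0 | _ => 0

/-- `X`-table of the one-visit seed of length twelve no. 8. [cite: EntingJensen2009, §7.4.2, Fig. 7.10] -/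
def x8 : ℕ → ℤ
  | 0 => 0 | 1 => 1 | 2 => 1 | 3 => 0 | 4 => 0 | 5 => 1 | 6 => 2 | 7 => 2 | 8 => 3 | 9 => 4 | 10 => 5 | 11 => 5 | _ => 6

/-- `Y`-table of the one-visit seed of length twelve no. 8. [cite: EntingJensen2009, §7.4.2, Fig. 7.10] -/
def y8 : ℕ → ℤ
  | 0 => 0 | 1 => 0 | 2 => -1 | 3 => -1 | 4 => -2 | 5 => -2 | 6 => -2 | 7 => -1 | 8 => -1 | 9 => -1 | 10 => -1 | 11 => 0 | _ => 0

/-- The nine `X`-tables as one family. [cite: EntingJensen2009, §7.4.2, Fig. 7.10] -/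
def TX : Fin 9 → ℕ → ℤ
  | ⟨0, _⟩ => x0 | ⟨1, _⟩ => x1 | ⟨2, _⟩ => x2 | ⟨3, _⟩ => x3 | ⟨4, _⟩ => x4 | ⟨5, _⟩ => x5 | ⟨6, _⟩ => x6 | ⟨7, _⟩ => x7 | _ => x8

/-- The nine `Y`-tables as one family. [cite: EntingJensen2009, §7.4.2, Fig. 7.10] -/
def TY : Fin 9 → ℕ → ℤ
  | ⟨0, _⟩ => y0 | ⟨1, _⟩ => y1 | ⟨2, _⟩ => y2 | ⟨3, _⟩ => y3 | ⟨4, _⟩ => y4 | ⟨5, _⟩ => y5 | ⟨6, _⟩ => y6 | ⟨7, _⟩ => y7 | _ => y8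

/-- **The nine one-visit seeds of length twelve** as explicit walks. [cite: EntingJensen2009, §7.4.2, Fig. 7.10] -/
def W (i : Fin 9) : ℕ → Site 2 := Tab.walk 12 (TX i) (TY i)

/-- Coordinate facts of all nine seeds, by `decide`. [cite: EntingJensen2009, §7.4.2, Fig. 7.10] -/
theorem facts : ∀ i : Fin 9, Tab.Facts₀ 12 (TX i) (TY i) := by unfold Tab.Facts₀; decide

/-- One surface visit each (kernel evaluation). [cite: BeatonBousquetMelouDeGierDuminilCopinGuttmann2014, §3.1 (arXiv v5 p. 8: c(ω), the number of contacts with the surface)] -/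
theorem visits_W : ∀ i : Fin 9, visits 12 (W i) = 1 := by decide

/-- An injective code: the abscissae at times `5`, `7`, `10`. [cite: EntingJensen2009, §7.4.2, Fig. 7.10] -/
theorem code_injective : ∀ i j : Fin 9, TX i 5 = TX j 5 → TX i 7 = TX j 7 → TX i 10 = TX j 10 → i = j := by decide

/-- The nine seeds are pairwise distinct. [cite: EntingJensen2009, §7.4.2, Fig. 7.10] -/
theorem W_injective : Function.Injective W := by
  intro i j h
  have h5 := congrFun (congrFun h 5) 0
  have h7 := congrFun (congrFun h 7) 0
  have h10 := congrFun (congrFun h 10) 0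
  simp only [W, Tab.walk, Arm.pt_apply_zero, show min 5 12 = 5 from rfl, show min 7 12 = 7 from rfl, show min 10 12 = 10 from rfl]
    at h5 h7 h10
  exact code_injective i j h5 h7 h10

/-- The nine seeds are one-visit wall bridges of length twelve (length symbolic). [cite: MadrasSlade1993, §1.2, Definition 1.2.1 (bridges); JansevanRensburg2000, §3.3.2, Lemma 3.20] -/
theorem W_mem_seeds : ∀ m', m' = 12 → ∀ i : Fin 9, W i ∈ seeds m' := by
  intro m' hm i
  obtain ⟨h0, hfr, hbw, hinj, hH, harch, hwb⟩ := Tab.walk_components₀ (facts i)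
  have h2 : visits m' (W i) = 1 := by rw [hm]; exact visits_W i
  have h1 : W i ∈ wbr m' := by
    rw [mem_wbr, mem_archs, mem_hpw, mem_saws_iff]
    subst hm
    exact ⟨⟨⟨⟨h0, hfr, hbw, hinj⟩, hH⟩, harch⟩, hwb⟩
  rw [seeds, Finset.mem_filter]
  exact ⟨h1, h2⟩

end Twelve

open Classical in
/-- ★ **`9 ≤ h₁₂ = wbrN 12 1`**: the nine explicit one-visit seeds of length twelve. [cite: JansevanRensburg2000, §3.3.2, Lemma 3.20; EntingJensen2009, §7.4.2, Fig. 7.10] -/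
theorem nine_le_wbrN_twelve_one : 9 ≤ wbrN 12 1 := by
  have key : ∀ m', m' = 12 → 9 ≤ #(seeds m') := by
    intro m' hm
    calc 9 = #(Finset.univ : Finset (Fin 9)) := by simp
      _ ≤ #(seeds m') := Finset.card_le_card_of_injOn Twelve.W (fun i _ => Twelve.W_mem_seeds m' hm i)
          (Twelve.W_injective.injOn)
  rw [← card_seeds]
  exact key 12 rfl

/-! ### §3  THE FIVE-SEED RENEWAL: six pairwise disjoint injections -/

set_option maxHeartbeats 400000 in
open Classical in
/-- ★★ **THE FIVE-SEED RECURSION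
`y B^w_{n+12} + ℓ₆ y B^w_{n+8} + ℓ₈ y B^w_{n+6} + ℓ₁₀ y B^w_{n+4} + y² B^w_{n+2} + h₁₂ y² B^w_n ≤ B^w_{n+14}`** (`y ≥ 0`; `ℓ_m = lsN m`,
`h₁₂ = wbrN 12 1`): the five families of `WB_four_seed_rec` (junction; direct dip / flat / left-proper ten; junction + left hook), shifted by two,
and a sixth — a wall bridge of length `n` extended by the junction and ANY one-visit seed of length twelve.  The new family sits inside its
seed (off the row) at the times `n+4`, `n+6`, `n+8`, `n+12` where, respectively, the junction + left-hook family has its junction end, the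
ten / flat / dip families are glued, and the junction family is glued — so all fifteen pairs are disjoint.
[cite: HammersleyTorrieWhittington1982, §2 (concatenation of surface bridges)] [cite: JansevanRensburg2000, §3.1.1, Assumptions 3.1(3), eqn (3.1)] [cite: MadrasSlade1993, §1.2, (1.2.15)] -/
theorem WB_five_seed_rec (n : ℕ) (hy : 0 ≤ y) :
    y * WB (n + 12) y + (lsN 6 : ℝ) * y * WB (n + 8) y + (lsN 8 : ℝ) * y * WB (n + 6) y + (lsN 10 : ℝ) * y * WB (n + 4) y +
        y ^ 2 * WB (n + 2) y + (wbrN 12 1 : ℝ) * y ^ 2 * WB n y ≤ WB (n + 14) y := by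
  suffices h : ∀ a b c d : ℕ, a = 6 → b = 8 → c = 10 → d = 12 →
      y * WB (n + 12) y + (lsN a : ℝ) * y * WB (n + 8) y + (lsN b : ℝ) * y * WB (n + 6) y + (lsN c : ℝ) * y * WB (n + 4) y +
        y ^ 2 * WB (n + 2) y + (wbrN d 1 : ℝ) * y ^ 2 * WB n y ≤ WB (n + 14) y from h 6 8 10 12 rfl rfl rfl rfl
  intro a b c d ha hb hc hd
  set triv : ℕ → Site 2 := Zd.straightWalk 2 0 with htriv
  have htm : triv ∈ wbr 0 := straightWalk_zero_mem_wbr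
  obtain ⟨hu, huv⟩ := Ten.lw_mem_wbr c hc
  set fU : (ℕ → Site 2) → (ℕ → Site 2) := fun ω => jcat (n + 12) ω triv with hfU
  set fD : ℕ → (ℕ → Site 2) × (ℕ → Site 2) → (ℕ → Site 2) := fun k q => Zd.concatWalk k q.1 q.2 with hfD
  set fJ : (ℕ → Site 2) → (ℕ → Site 2) := fun ω => jcat (n + 2) ω Ten.lw with hfJ
  set fT : (ℕ → Site 2) × (ℕ → Site 2) → (ℕ → Site 2) := fun q => jcat n q.1 q.2 with hfT
  set H₆ := (wbr (n + 8)) ×ˢ lseeds a with hH₆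
  set H₈ := (wbr (n + 6)) ×ˢ lseeds b with hH₈
  set H₁₀ := (wbr (n + 4)) ×ˢ lseeds c with hH₁₀
  set H₁₂ := (wbr n) ×ˢ seeds d with hH₁₂
  set N := n + 14 with hN
  -- generic facts about the direct families
  have Dfacts : ∀ {k m' : ℕ} (hkm : k + m' = N) {q : (ℕ → Site 2) × (ℕ → Site 2)}, q ∈ (wbr k) ×ˢ lseeds m' →
      fD k q ∈ wbr N ∧ visits N (fD k q) = visits k q.1 + 1 ∧ fD k q k 1 = 0 ∧
        (∀ t, t % 2 = 0 → 0 < t → t < m' → fD k q (k + t) 1 ≠ 0) ∧ (3 ≤ m' → fD k q k 0 + 1 ≤ fD k q (k + 3) 0) := by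
    intro k m' hkm q hq
    obtain ⟨hq1, hq2⟩ := Finset.mem_product.1 hq
    obtain ⟨hυw, hυv, hυl⟩ := mem_lseeds.1 hq2
    obtain ⟨h1, h2⟩ := dcat_spec hq1 hυw hυl
    rw [hkm] at h1 h2
    rw [hυv] at h2
    exact ⟨h1, h2, dcat_apply_self_one hq1 _, fun t ht h0 htm' => dcat_seed_apply_one_at hq1 hυw hυv ht h0 htm',
      fun h3 => dcat_apply_add_three_zero _ hυw hυl h3⟩
  have Ufacts : ∀ {ω}, ω ∈ wbr (n + 12) → fU ω ∈ wbr N ∧ visits N (fU ω) = visits (n + 12) ω + 1 ∧ fU ω (n + 12) 1 = 0 := by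
    intro ω hω
    have sp := jcat_spec hω htm
    rw [show n + 12 + (2 + 0) = N by omega, visits_zero, add_zero] at sp
    exact ⟨sp.1, sp.2, jcat_apply_self_one hω⟩
  have Jfacts : ∀ {ω}, ω ∈ wbr (n + 2) → fJ ω ∈ wbr N ∧ visits N (fJ ω) = visits (n + 2) ω + 2 ∧
      (∀ t, t % 2 = 0 → 0 < t → t < c → fJ ω (n + 2 + (2 + t)) 1 ≠ 0) ∧ fJ ω (n + 4) 0 = fJ ω (n + 7) 0 ∧ fJ ω (n + 4) 1 = 0 := by
    intro ω hω
    have sp := jcat_spec hω hu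
    rw [show n + 2 + (2 + c) = N by omega, huv] at sp
    refine ⟨sp.1, by rw [sp.2], fun t ht h0 ht10 => jcat_seed_apply_one_at hω hu huv ht h0 ht10, ?_, ?_⟩
    · have hT0 : tailPiece Ten.lw 0 = 0 := (mem_saws_iff.1 (tailPiece_spec hu).1).1
      have hu0 : Ten.lw 0 = 0 := (mem_saws_iff.1 (hpw_subset (archs_subset (wbr_subset hu)))).1
      have e2 : fJ ω (n + 4) = ω (n + 2) + tailPiece Ten.lw 2 := Zd.concatWalk_apply_add _ _ hT0 2
      have e5 : fJ ω (n + 7) = ω (n + 2) + tailPiece Ten.lw (2 + 3) := Zd.concatWalk_apply_add _ _ hT0 5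
      rw [e2, e5, Pi.add_apply, Pi.add_apply, tailPiece_apply_zero_of_le _ le_rfl, tailPiece_apply_add_zero hu0,
        Ten.lw_three_zero.1]
      push_cast; ring
    · have := jcat_junction_end_one hω hu
      rwa [show n + 2 + 2 = n + 4 by omega] at this
  have Tfacts : ∀ {q : (ℕ → Site 2) × (ℕ → Site 2)}, q ∈ H₁₂ → fT q ∈ wbr N ∧ visits N (fT q) = visits n q.1 + 2 ∧
      (∀ t, t % 2 = 0 → 0 < t → t < d → fT q (n + (2 + t)) 1 ≠ 0) := by
    intro q hq
    obtain ⟨hq1, hq2⟩ := Finset.mem_product.1 hq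
    rw [seeds] at hq2
    obtain ⟨hυw, hυv⟩ := Finset.mem_filter.1 hq2
    have sp := jcat_spec hq1 hυw
    rw [show n + (2 + d) = N by omega, hυv] at sp
    exact ⟨sp.1, by rw [sp.2], fun t ht h0 htd => jcat_seed_apply_one_at hq1 hυw hυv ht h0 htd⟩
  -- images lie in wbr N
  have hUT : (wbr (n + 12)).image fU ⊆ wbr N := by
    intro ζ hζ; obtain ⟨ω, hω, rfl⟩ := Finset.mem_image.1 hζ; exact (Ufacts hω).1
  have hDT : ∀ {k m' : ℕ} (hkm : k + m' = N), ((wbr k) ×ˢ lseeds m').image (fD k) ⊆ wbr N := by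
    intro k m' hkm ζ hζ; obtain ⟨q, hq, rfl⟩ := Finset.mem_image.1 hζ; exact (Dfacts hkm hq).1
  have hJT : (wbr (n + 2)).image fJ ⊆ wbr N := by
    intro ζ hζ; obtain ⟨ω, hω, rfl⟩ := Finset.mem_image.1 hζ; exact (Jfacts hω).1
  have hTT : H₁₂.image fT ⊆ wbr N := by
    intro ζ hζ; obtain ⟨q, hq, rfl⟩ := Finset.mem_image.1 hζ; exact (Tfacts hq).1
  -- injectivity
  have hUinj : Set.InjOn fU ↑(wbr (n + 12)) := by
    intro ω hω ω' hω' h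
    have hωs := hpw_subset (archs_subset (wbr_subset (Finset.mem_coe.1 hω)))
    have hω's := hpw_subset (archs_subset (wbr_subset (Finset.mem_coe.1 hω')))
    exact (Zd.concatWalk_injective_pieces (saws_subset _ hωs) (saws_subset _ (tailPiece_spec htm).1)
      (saws_subset _ hω's) (saws_subset _ (tailPiece_spec htm).1) h).1
  have hJinj : Set.InjOn fJ ↑(wbr (n + 2)) := by
    intro ω hω ω' hω' h
    have hωs := hpw_subset (archs_subset (wbr_subset (Finset.mem_coe.1 hω)))
    have hω's := hpw_subset (archs_subset (wbr_subset (Finset.mem_coe.1 hω')))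
    exact (Zd.concatWalk_injective_pieces (saws_subset _ hωs) (saws_subset _ (tailPiece_spec hu).1)
      (saws_subset _ hω's) (saws_subset _ (tailPiece_spec hu).1) h).1
  have hDinj : ∀ (k m' : ℕ), Set.InjOn (fD k) ↑((wbr k) ×ˢ lseeds m') := fun k m' =>
    dcat_injOn k m' _ (Finset.product_subset_product_right (by
      intro υ hυ; exact (mem_lseeds.1 hυ).1))
  have hTinj : Set.InjOn fT ↑H₁₂ := by
    rintro ⟨ω₁, υ₁⟩ hq ⟨ω₂, υ₂⟩ hq' h
    have hq0 := Finset.mem_product.1 (Finset.mem_coe.1 hq)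
    have hq0' := Finset.mem_product.1 (Finset.mem_coe.1 hq')
    rw [seeds] at hq0 hq0'
    have hυw : υ₁ ∈ wbr d := (Finset.mem_filter.1 hq0.2).1
    have hυ'w : υ₂ ∈ wbr d := (Finset.mem_filter.1 hq0'.2).1
    have hωs := hpw_subset (archs_subset (wbr_subset hq0.1))
    have hω's := hpw_subset (archs_subset (wbr_subset hq0'.1))
    have hυs := hpw_subset (archs_subset (wbr_subset hυw))
    have hυ's := hpw_subset (archs_subset (wbr_subset hυ'w))
    obtain ⟨h1, h2⟩ := Zd.concatWalk_injective_pieces (saws_subset _ hωs) (saws_subset _ (tailPiece_spec hυw).1)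
      (saws_subset _ hω's) (saws_subset _ (tailPiece_spec hυ'w).1) h
    have h3 := tailPiece_injective (mem_saws_iff.1 hυs).1 (mem_saws_iff.1 hυ's).1 h2
    simp only [Prod.mk.injEq]
    exact ⟨h1, h3⟩
  -- a row criterion for disjointness
  have row_disjoint : ∀ {A B : Finset (ℕ → Site 2)} (t : ℕ), (∀ ζ ∈ A, ζ t 1 = 0) → (∀ ζ ∈ B, ζ t 1 ≠ 0) → Disjoint A B := by
    intro A B t hA hB
    rw [Finset.disjoint_left]
    intro ζ hζA hζB
    exact hB ζ hζB (hA ζ hζA)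
  -- on-row facts
  have U_on : ∀ ζ ∈ (wbr (n + 12)).image fU, ζ (n + 12) 1 = 0 := by
    intro ζ hζ; obtain ⟨ω, hω, rfl⟩ := Finset.mem_image.1 hζ; exact (Ufacts hω).2.2
  have D6_on : ∀ ζ ∈ H₆.image (fD (n + 8)), ζ (n + 8) 1 = 0 := by
    intro ζ hζ; obtain ⟨q, hq, rfl⟩ := Finset.mem_image.1 hζ; exact (Dfacts (m' := a) (by omega) hq).2.2.1
  have D8_on : ∀ ζ ∈ H₈.image (fD (n + 6)), ζ (n + 6) 1 = 0 := by
    intro ζ hζ; obtain ⟨q, hq, rfl⟩ := Finset.mem_image.1 hζ; exact (Dfacts (m' := b) (by omega) hq).2.2.1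
  have D10_on : ∀ ζ ∈ H₁₀.image (fD (n + 4)), ζ (n + 4) 1 = 0 := by
    intro ζ hζ; obtain ⟨q, hq, rfl⟩ := Finset.mem_image.1 hζ; exact (Dfacts (m' := c) (by omega) hq).2.2.1
  have J_on : ∀ ζ ∈ (wbr (n + 2)).image fJ, ζ (n + 4) 1 = 0 := by
    intro ζ hζ; obtain ⟨ω, hω, rfl⟩ := Finset.mem_image.1 hζ; exact (Jfacts hω).2.2.2.2
  -- off-row facts (inside a seed at a positive even seed time)
  have D_off : ∀ {k m' : ℕ} (hkm : k + m' = N) (t : ℕ), t % 2 = 0 → 0 < t → t < m' →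
      ∀ ζ ∈ ((wbr k) ×ˢ lseeds m').image (fD k), ζ (k + t) 1 ≠ 0 := by
    intro k m' hkm t ht h0 htm ζ hζ; obtain ⟨q, hq, rfl⟩ := Finset.mem_image.1 hζ; exact (Dfacts hkm hq).2.2.2.1 t ht h0 htm
  have J_off : ∀ (t : ℕ), t % 2 = 0 → 0 < t → t < c → ∀ ζ ∈ (wbr (n + 2)).image fJ, ζ (n + 2 + (2 + t)) 1 ≠ 0 := by
    intro t ht h0 htc ζ hζ; obtain ⟨ω, hω, rfl⟩ := Finset.mem_image.1 hζ; exact (Jfacts hω).2.2.1 t ht h0 htc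
  have T_off : ∀ (t : ℕ), t % 2 = 0 → 0 < t → t < d → ∀ ζ ∈ H₁₂.image fT, ζ (n + (2 + t)) 1 ≠ 0 := by
    intro t ht h0 htd ζ hζ; obtain ⟨q, hq, rfl⟩ := Finset.mem_image.1 hζ; exact (Tfacts hq).2.2 t ht h0 htd
  -- the fifteen pairwise disjointness statements
  set SU := (wbr (n + 12)).image fU
  set S6 := H₆.image (fD (n + 8))
  set S8 := H₈.image (fD (n + 6))
  set S10 := H₁₀.image (fD (n + 4))
  set SJ := (wbr (n + 2)).image fJ
  set ST := H₁₂.image fT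
  have dU6 : Disjoint SU S6 := row_disjoint (n + 12) U_on (by
    have h := D_off (k := n + 8) (m' := a) (by omega) 4 (by decide) (by norm_num) (by omega)
    rwa [show n + 8 + 4 = n + 12 by omega] at h)
  have dU8 : Disjoint SU S8 := row_disjoint (n + 12) U_on (by
    have h := D_off (k := n + 6) (m' := b) (by omega) 6 (by decide) (by norm_num) (by omega)
    rwa [show n + 6 + 6 = n + 12 by omega] at h)
  have dU10 : Disjoint SU S10 := row_disjoint (n + 12) U_on (by
    have h := D_off (k := n + 4) (m' := c) (by omega) 8 (by decide) (by norm_num) (by omega)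
    rwa [show n + 4 + 8 = n + 12 by omega] at h)
  have dUJ : Disjoint SU SJ := row_disjoint (n + 12) U_on (by
    have h := J_off 8 (by decide) (by norm_num) (by omega)
    rwa [show n + 2 + (2 + 8) = n + 12 by omega] at h)
  have dUT : Disjoint SU ST := row_disjoint (n + 12) U_on (by
    have h := T_off 10 (by decide) (by norm_num) (by omega)
    rwa [show n + (2 + 10) = n + 12 by omega] at h)
  have d68 : Disjoint S6 S8 := row_disjoint (n + 8) D6_on (by
    have h := D_off (k := n + 6) (m' := b) (by omega) 2 (by decide) (by norm_num) (by omega)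
    rwa [show n + 6 + 2 = n + 8 by omega] at h)
  have d610 : Disjoint S6 S10 := row_disjoint (n + 8) D6_on (by
    have h := D_off (k := n + 4) (m' := c) (by omega) 4 (by decide) (by norm_num) (by omega)
    rwa [show n + 4 + 4 = n + 8 by omega] at h)
  have d6J : Disjoint S6 SJ := row_disjoint (n + 8) D6_on (by
    have h := J_off 4 (by decide) (by norm_num) (by omega)
    rwa [show n + 2 + (2 + 4) = n + 8 by omega] at h)
  have d6T : Disjoint S6 ST := row_disjoint (n + 8) D6_on (by
    have h := T_off 6 (by decide) (by norm_num) (by omega)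
    rwa [show n + (2 + 6) = n + 8 by omega] at h)
  have d810 : Disjoint S8 S10 := row_disjoint (n + 6) D8_on (by
    have h := D_off (k := n + 4) (m' := c) (by omega) 2 (by decide) (by norm_num) (by omega)
    rwa [show n + 4 + 2 = n + 6 by omega] at h)
  have d8J : Disjoint S8 SJ := row_disjoint (n + 6) D8_on (by
    have h := J_off 2 (by decide) (by norm_num) (by omega)
    rwa [show n + 2 + (2 + 2) = n + 6 by omega] at h)
  have d8T : Disjoint S8 ST := row_disjoint (n + 6) D8_on (by
    have h := T_off 4 (by decide) (by norm_num) (by omega)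
    rwa [show n + (2 + 4) = n + 6 by omega] at h)
  have d10T : Disjoint S10 ST := row_disjoint (n + 4) D10_on (by
    have h := T_off 2 (by decide) (by norm_num) (by omega)
    rwa [show n + (2 + 2) = n + 4 by omega] at h)
  have dJT : Disjoint SJ ST := row_disjoint (n + 4) J_on (by
    have h := T_off 2 (by decide) (by norm_num) (by omega)
    rwa [show n + (2 + 2) = n + 4 by omega] at h)
  have d10J : Disjoint S10 SJ := by
    rw [Finset.disjoint_left]
    intro ζ hζD hζJ
    obtain ⟨q, hq, rfl⟩ := Finset.mem_image.1 hζD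
    obtain ⟨ω, hω, he⟩ := Finset.mem_image.1 hζJ
    have h1 := (Dfacts (m' := c) (by omega) hq).2.2.2.2 (by omega)
    have h2 := (Jfacts hω).2.2.2.1
    rw [he] at h2
    rw [show n + 4 + 3 = n + 7 by omega] at h1
    omega
  -- the six sums
  have hsumU : ∑ ζ ∈ SU, y ^ visits N ζ = y * WB (n + 12) y := by
    rw [Finset.sum_image hUinj, WB, Finset.mul_sum]
    refine Finset.sum_congr rfl fun ω hω => ?_
    rw [(Ufacts hω).2.1, pow_succ, mul_comm]
  have hsumD : ∀ {k m' : ℕ} (hkm : k + m' = N),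
      ∑ ζ ∈ ((wbr k) ×ˢ lseeds m').image (fD k), y ^ visits N ζ = (lsN m' : ℝ) * y * WB k y := by
    intro k m' hkm
    rw [Finset.sum_image (hDinj k m'), Finset.sum_product, WB, Finset.mul_sum]
    refine Finset.sum_congr rfl fun ω hω => ?_
    have hterm : ∀ υ ∈ lseeds m', y ^ visits N (fD k (ω, υ)) = y * y ^ visits k ω := by
      intro υ hυ
      rw [(Dfacts hkm (Finset.mem_product.2 ⟨hω, hυ⟩)).2.1, pow_succ, mul_comm]
    rw [Finset.sum_congr rfl hterm, Finset.sum_const, nsmul_eq_mul, lsN]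
    ring
  have hsumJ : ∑ ζ ∈ SJ, y ^ visits N ζ = y ^ 2 * WB (n + 2) y := by
    rw [Finset.sum_image hJinj, WB, Finset.mul_sum]
    refine Finset.sum_congr rfl fun ω hω => ?_
    rw [(Jfacts hω).2.1, pow_add, mul_comm]
  have hsumT : ∑ ζ ∈ ST, y ^ visits N ζ = (wbrN d 1 : ℝ) * y ^ 2 * WB n y := by
    rw [Finset.sum_image hTinj, Finset.sum_product, WB, Finset.mul_sum]
    refine Finset.sum_congr rfl fun ω hω => ?_
    have hterm : ∀ υ ∈ seeds d, y ^ visits N (fT (ω, υ)) = y ^ 2 * y ^ visits n ω := by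
      intro υ hυ
      rw [(Tfacts (Finset.mem_product.2 ⟨hω, hυ⟩)).2.1, pow_add, mul_comm]
    rw [Finset.sum_congr rfl hterm, Finset.sum_const, card_seeds, nsmul_eq_mul]
    ring
  have hsum6 := hsumD (k := n + 8) (m' := a) (by omega)
  have hsum8 := hsumD (k := n + 6) (m' := b) (by omega)
  have hsum10 := hsumD (k := n + 4) (m' := c) (by omega)
  -- assemble
  have dA : Disjoint SU (S6 ∪ (S8 ∪ (S10 ∪ (SJ ∪ ST)))) :=
    Finset.disjoint_union_right.2 ⟨dU6, Finset.disjoint_union_right.2 ⟨dU8, Finset.disjoint_union_right.2 ⟨dU10,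
      Finset.disjoint_union_right.2 ⟨dUJ, dUT⟩⟩⟩⟩
  have dB : Disjoint S6 (S8 ∪ (S10 ∪ (SJ ∪ ST))) :=
    Finset.disjoint_union_right.2 ⟨d68, Finset.disjoint_union_right.2 ⟨d610, Finset.disjoint_union_right.2 ⟨d6J, d6T⟩⟩⟩
  have dC : Disjoint S8 (S10 ∪ (SJ ∪ ST)) := Finset.disjoint_union_right.2 ⟨d810, Finset.disjoint_union_right.2 ⟨d8J, d8T⟩⟩
  have dD : Disjoint S10 (SJ ∪ ST) := Finset.disjoint_union_right.2 ⟨d10J, d10T⟩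
  have hsub : SU ∪ (S6 ∪ (S8 ∪ (S10 ∪ (SJ ∪ ST)))) ⊆ wbr N :=
    Finset.union_subset hUT (Finset.union_subset (hDT (by omega))
      (Finset.union_subset (hDT (by omega)) (Finset.union_subset (hDT (by omega)) (Finset.union_subset hJT hTT))))
  calc y * WB (n + 12) y + (lsN a : ℝ) * y * WB (n + 8) y + (lsN b : ℝ) * y * WB (n + 6) y + (lsN c : ℝ) * y * WB (n + 4) y +
        y ^ 2 * WB (n + 2) y + (wbrN d 1 : ℝ) * y ^ 2 * WB n y
      = ∑ ζ ∈ SU ∪ (S6 ∪ (S8 ∪ (S10 ∪ (SJ ∪ ST)))), y ^ visits N ζ := by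
        rw [Finset.sum_union dA, Finset.sum_union dB, Finset.sum_union dC, Finset.sum_union dD, Finset.sum_union dJT, hsumU,
          hsum6, hsum8, hsum10, hsumJ, hsumT]
        ring
    _ ≤ ∑ ζ ∈ wbr N, y ^ visits N ζ := Finset.sum_le_sum_of_subset_of_nonneg hsub fun _ _ _ => pow_nonneg hy _
    _ = WB (n + 14) y := by rw [WB]

/-! ### §4  Subsolutions of the five-seed recursion are lower bounds for `β(y)²` -/

set_option maxHeartbeats 400000 in
/-- ★ **Every positive subsolution of the five-seed recursion is a lower bound**: if `x > 0` and
`x⁷ ≤ y x⁶ + ℓ₆ y x⁴ + ℓ₈ y x³ + ℓ₁₀ y x² + y² x + h₁₂ y²` then `x ≤ β(y)²`.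
[cite: MadrasSlade1993, §1.2, (1.2.15)–(1.2.17)] [cite: HammersleyTorrieWhittington1982, §2] -/
theorem le_sq_wallRate_of_five_seed_subsolution (hy : 0 < y) {x : ℝ} (hx : 0 < x)
    (hsub : x ^ 7 ≤ y * x ^ 6 + (lsN 6 : ℝ) * y * x ^ 4 + (lsN 8 : ℝ) * y * x ^ 3 + (lsN 10 : ℝ) * y * x ^ 2 + y ^ 2 * x +
      (wbrN 12 1 : ℝ) * y ^ 2) : x ≤ wallRate y ^ 2 := by
  set l₆ : ℝ := (lsN 6 : ℝ) with hl6
  set l₈ : ℝ := (lsN 8 : ℝ) with hl8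
  set l₁₀ : ℝ := (lsN 10 : ℝ) with hl10
  set h₁₂ : ℝ := (wbrN 12 1 : ℝ) with hh12
  have hl60 : 0 ≤ l₆ := Nat.cast_nonneg _
  have hl80 : 0 ≤ l₈ := Nat.cast_nonneg _
  have hl100 : 0 ≤ l₁₀ := Nat.cast_nonneg _
  have hh120 : 0 ≤ h₁₂ := Nat.cast_nonneg _
  set E : ℕ → ℝ := fun j => WB (2 * j) y with hE
  have hEpos : ∀ j, 0 < E j := fun j => WB_pos hy j
  have hrec : ∀ j, y * E (j + 6) + l₆ * y * E (j + 4) + l₈ * y * E (j + 3) + l₁₀ * y * E (j + 2) + y ^ 2 * E (j + 1) +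
      h₁₂ * y ^ 2 * E j ≤ E (j + 7) := by
    intro j
    have := WB_five_seed_rec (2 * j) hy.le
    simp only [hE]
    rw [show 2 * (j + 6) = 2 * j + 12 by ring, show 2 * (j + 4) = 2 * j + 8 by ring, show 2 * (j + 3) = 2 * j + 6 by ring,
      show 2 * (j + 2) = 2 * j + 4 by ring, show 2 * (j + 1) = 2 * j + 2 by ring, show 2 * (j + 7) = 2 * j + 14 by ring]
    exact this
  have hne : (Finset.range 7).Nonempty := ⟨0, by simp⟩
  set c : ℝ := (Finset.range 7).inf' hne (fun j => E j / x ^ j) with hc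
  have hcpos : 0 < c := by
    rw [hc, Finset.lt_inf'_iff]
    exact fun j _ => div_pos (hEpos j) (pow_pos hx j)
  have hbase : ∀ j < 7, c * x ^ j ≤ E j := by
    intro j hj
    have hcj : c ≤ E j / x ^ j := Finset.inf'_le _ (Finset.mem_range.2 hj)
    exact (le_div_iff₀ (pow_pos hx j)).1 hcj
  have hall : ∀ j, c * x ^ j ≤ E j := by
    intro j
    induction j using Nat.strong_induction_on with
    | _ j ih =>
      rcases lt_or_ge j 7 with hj | hj
      · exact hbase j hj
      · obtain ⟨i, rfl⟩ : ∃ i, j = i + 7 := ⟨j - 7, by omega⟩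
        have h6 := ih (i + 6) (by omega)
        have h4 := ih (i + 4) (by omega)
        have h3 := ih (i + 3) (by omega)
        have h2 := ih (i + 2) (by omega)
        have h1 := ih (i + 1) (by omega)
        have h0 := ih i (by omega)
        calc c * x ^ (i + 7) = c * x ^ i * x ^ 7 := by ring
          _ ≤ c * x ^ i * (y * x ^ 6 + l₆ * y * x ^ 4 + l₈ * y * x ^ 3 + l₁₀ * y * x ^ 2 + y ^ 2 * x + h₁₂ * y ^ 2) :=
              mul_le_mul_of_nonneg_left hsub (mul_nonneg hcpos.le (pow_nonneg hx.le _))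
          _ = y * (c * x ^ (i + 6)) + l₆ * y * (c * x ^ (i + 4)) + l₈ * y * (c * x ^ (i + 3)) + l₁₀ * y * (c * x ^ (i + 2)) +
                y ^ 2 * (c * x ^ (i + 1)) + h₁₂ * y ^ 2 * (c * x ^ i) := by ring
          _ ≤ y * E (i + 6) + l₆ * y * E (i + 4) + l₈ * y * E (i + 3) + l₁₀ * y * E (i + 2) + y ^ 2 * E (i + 1) +
                h₁₂ * y ^ 2 * E i := by
              have a6 := mul_le_mul_of_nonneg_left h6 hy.le
              have a4 := mul_le_mul_of_nonneg_left h4 (mul_nonneg hl60 hy.le)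
              have a3 := mul_le_mul_of_nonneg_left h3 (mul_nonneg hl80 hy.le)
              have a2 := mul_le_mul_of_nonneg_left h2 (mul_nonneg hl100 hy.le)
              have a1 := mul_le_mul_of_nonneg_left h1 (pow_nonneg hy.le 2)
              have a0 := mul_le_mul_of_nonneg_left h0 (mul_nonneg hh120 (pow_nonneg hy.le 2))
              linarith
          _ ≤ E (i + 7) := hrec i
  set B : ℝ := wallRate y ^ 2 with hB
  have hβ := wallRate_pos y
  have hBpos : 0 < B := pow_pos hβ 2
  have hup : ∀ j, E j ≤ B / y * B ^ j := by
    intro j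
    have := WB_le_pow hy (2 * j)
    simp only [hE]
    rw [hB, ← pow_mul]
    exact this
  by_contra hlt
  push Not at hlt
  have hratio : 1 < x / B := (one_lt_div hBpos).2 hlt
  have hbd : ∀ j, (x / B) ^ j ≤ B / (y * c) := by
    intro j
    have h1 : c * x ^ j ≤ B / y * B ^ j := (hall j).trans (hup j)
    have h1' : c * x ^ j * y ≤ B * B ^ j := by
      rw [div_mul_eq_mul_div, le_div_iff₀ hy] at h1
      exact h1
    rw [div_pow, div_le_div_iff₀ (pow_pos hBpos j) (mul_pos hy hcpos)]
    linarith
  obtain ⟨j, hj⟩ := ((tendsto_pow_atTop_atTop_of_one_lt hratio).eventually_gt_atTop (B / (y * c))).exists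
  exact absurd (hbd j) (not_le.2 hj)

/-- ★★ **THE FIVE-SEED FREE-ENERGY INEQUALITY `y β¹² + ℓ₆ y β⁸ + ℓ₈ y β⁶ + ℓ₁₀ y β⁴ + y² β² + h₁₂ y² ≤ β¹⁴`** (every `y > 0`).
[cite: JansevanRensburg2000, §3.3.2, Lemma 3.20] [cite: HammersleyTorrieWhittington1982, §2] [cite: MadrasSlade1993, §1.2, (1.2.17)] -/
theorem five_seed_le_wallRate_pow_fourteen (hy : 0 < y) :
    y * wallRate y ^ 12 + (lsN 6 : ℝ) * y * wallRate y ^ 8 + (lsN 8 : ℝ) * y * wallRate y ^ 6 + (lsN 10 : ℝ) * y * wallRate y ^ 4 +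
        y ^ 2 * wallRate y ^ 2 + (wbrN 12 1 : ℝ) * y ^ 2 ≤ wallRate y ^ 14 := by
  set B : ℝ := wallRate y ^ 2 with hB
  have hBpos : 0 < B := pow_pos (wallRate_pos y) 2
  have e12 : wallRate y ^ 12 = B ^ 6 := by rw [hB, ← pow_mul]
  have e8 : wallRate y ^ 8 = B ^ 4 := by rw [hB, ← pow_mul]
  have e6 : wallRate y ^ 6 = B ^ 3 := by rw [hB, ← pow_mul]
  have e4 : wallRate y ^ 4 = B ^ 2 := by rw [hB, ← pow_mul]
  have e14 : wallRate y ^ 14 = B ^ 7 := by rw [hB, ← pow_mul]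
  rw [e12, e8, e6, e4, e14]
  by_contra hlt
  push Not at hlt
  set g : ℝ → ℝ := fun x => y * x ^ 6 + (lsN 6 : ℝ) * y * x ^ 4 + (lsN 8 : ℝ) * y * x ^ 3 + (lsN 10 : ℝ) * y * x ^ 2 + y ^ 2 * x +
    (wbrN 12 1 : ℝ) * y ^ 2 - x ^ 7 with hg
  have hgB : 0 < g B := by simp only [hg]; linarith
  have hcont : Continuous g := by simp only [hg]; fun_prop
  have hnhds : {x | 0 < g x} ∈ 𝓝 B := hcont.continuousAt.preimage_mem_nhds (Ioi_mem_nhds hgB)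
  have hev : ∀ᶠ x in 𝓝[Set.Ioi B] B, 0 < g x := eventually_nhdsWithin_of_eventually_nhds hnhds
  obtain ⟨x, hxg, hxB⟩ := (hev.and self_mem_nhdsWithin).exists
  have hxB' : B < x := hxB
  have hx : 0 < x := hBpos.trans hxB'
  have hsub : x ^ 7 ≤ y * x ^ 6 + (lsN 6 : ℝ) * y * x ^ 4 + (lsN 8 : ℝ) * y * x ^ 3 + (lsN 10 : ℝ) * y * x ^ 2 + y ^ 2 * x +
      (wbrN 12 1 : ℝ) * y ^ 2 := by
    simp only [hg] at hxg; linarith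
  exact absurd (le_sq_wallRate_of_five_seed_subsolution hy hx hsub) (not_le.2 hxB')

/-- ★★ **`β(y)² ≥ y + y/β⁴ + y/β⁶ + 3y/β⁸ + y²/β¹⁰ + 9y²/β¹²`** (every `y > 0`; `ℓ₆, ℓ₈ ≥ 1`, `ℓ₁₀ ≥ 3`, `h₁₂ ≥ 9`).
[cite: JansevanRensburg2000, §3.3.2, Lemma 3.20] [cite: HammersleyTorrieWhittington1982, §2] -/
theorem add_five_seed_div_le_sq_wallRate (hy : 0 < y) :
    y + y / wallRate y ^ 4 + y / wallRate y ^ 6 + 3 * y / wallRate y ^ 8 + y ^ 2 / wallRate y ^ 10 + 9 * y ^ 2 / wallRate y ^ 12 ≤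
      wallRate y ^ 2 := by
  have hβ := wallRate_pos y
  have h12 : 0 < wallRate y ^ 12 := pow_pos hβ 12
  have key := five_seed_le_wallRate_pow_fourteen hy
  have h6 : (1 : ℝ) ≤ lsN 6 := by exact_mod_cast one_le_lsN_six
  have h8 : (1 : ℝ) ≤ lsN 8 := by exact_mod_cast one_le_lsN_eight
  have h10 : (3 : ℝ) ≤ lsN 10 := by exact_mod_cast three_le_lsN_ten
  have h12' : (9 : ℝ) ≤ wbrN 12 1 := by exact_mod_cast nine_le_wbrN_twelve_one
  have key' : y * wallRate y ^ 12 + y * wallRate y ^ 8 + y * wallRate y ^ 6 + 3 * y * wallRate y ^ 4 + y ^ 2 * wallRate y ^ 2 + 9 * y ^ 2 ≤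
      wallRate y ^ 14 := by
    have a : y * wallRate y ^ 8 ≤ (lsN 6 : ℝ) * y * wallRate y ^ 8 := by
      rw [mul_assoc]; exact le_mul_of_one_le_left (by positivity) h6
    have b : y * wallRate y ^ 6 ≤ (lsN 8 : ℝ) * y * wallRate y ^ 6 := by
      rw [mul_assoc]; exact le_mul_of_one_le_left (by positivity) h8
    have c : 3 * y * wallRate y ^ 4 ≤ (lsN 10 : ℝ) * y * wallRate y ^ 4 := by
      rw [mul_assoc, mul_assoc]; exact mul_le_mul_of_nonneg_right h10 (by positivity)
    have d : 9 * y ^ 2 ≤ (wbrN 12 1 : ℝ) * y ^ 2 := mul_le_mul_of_nonneg_right h12' (by positivity)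
    linarith
  have e : y + y / wallRate y ^ 4 + y / wallRate y ^ 6 + 3 * y / wallRate y ^ 8 + y ^ 2 / wallRate y ^ 10 + 9 * y ^ 2 / wallRate y ^ 12 =
      (y * wallRate y ^ 12 + y * wallRate y ^ 8 + y * wallRate y ^ 6 + 3 * y * wallRate y ^ 4 + y ^ 2 * wallRate y ^ 2 + 9 * y ^ 2) /
        wallRate y ^ 12 := by
    field_simp
  rw [e, div_le_iff₀ h12, show wallRate y ^ 2 * wallRate y ^ 12 = wallRate y ^ 14 by ring]
  exact key'

/-! ### §5  THE FIFTH-ORDER LOWER WINDOW under a fourth-order upper window -/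

/-- Bernoulli from below, one more power: `(Y − 6p)(Y + p)⁶ ≤ Y⁷` (`Y, p ≥ 0`). [cite: MadrasSlade1993, §1.2, (1.2.17)] -/
theorem bernoulli_inv_six {Y p : ℝ} (hY : 0 ≤ Y) (hp : 0 ≤ p) : (Y - 6 * p) * (Y + p) ^ 6 ≤ Y ^ 7 := by
  have h2 : 0 ≤ p ^ 2 := sq_nonneg p
  nlinarith [mul_nonneg (pow_nonneg hY 5) h2, mul_nonneg (pow_nonneg hY 4) (mul_nonneg hp h2),
    mul_nonneg (pow_nonneg hY 3) (mul_nonneg h2 h2), mul_nonneg (mul_nonneg hY hY) (mul_nonneg hp (mul_nonneg h2 h2)),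
    mul_nonneg hY (mul_nonneg h2 (mul_nonneg h2 h2)), mul_nonneg hp (mul_nonneg h2 (mul_nonneg h2 h2))]

set_option maxHeartbeats 400000 in
/-- ★★★ **THE FIFTH-ORDER LOWER WINDOW UNDER A FOURTH-ORDER UPPER WINDOW**: if `β(y)² ≤ y + 1/y + 1/y² + 2/y³ + C/y⁴` (`C ≥ 0`, `y > 0`),
then `β(y)² ≥ y + 1/y + 1/y² + 2/y³ + 4/y⁴ − 24/y⁵ − (77+2C)/y⁶ − (88+3C)/y⁷ − (108+17C)/y⁸ − 54C/y⁹` (insert the upper window into the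
five denominators of `add_five_seed_div_le_sq_wallRate`; first-order Bernoulli suffices). [cite: JansevanRensburg2000, §3.3.2, Lemma 3.20] [cite: HammersleyTorrieWhittington1982, §2] [cite: BeatonBousquetMelouDeGierDuminilCopinGuttmann2014, §3.1, Proposition 5 (arXiv v5 p. 9)] -/
theorem fifth_window_lower (hy : 0 < y) {C : ℝ} (hC : 0 ≤ C) (hup : wallRate y ^ 2 ≤ y + 1 / y + 1 / y ^ 2 + 2 / y ^ 3 + C / y ^ 4) :
    y + 1 / y + 1 / y ^ 2 + 2 / y ^ 3 + 4 / y ^ 4 - 24 / y ^ 5 - (77 + 2 * C) / y ^ 6 - (88 + 3 * C) / y ^ 7 - (108 + 17 * C) / y ^ 8 -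
        54 * C / y ^ 9 ≤ wallRate y ^ 2 := by
  have hβ := wallRate_pos y
  have key := add_five_seed_div_le_sq_wallRate hy
  rw [show wallRate y ^ 4 = (wallRate y ^ 2) ^ 2 by ring, show wallRate y ^ 6 = (wallRate y ^ 2) ^ 3 by ring,
    show wallRate y ^ 8 = (wallRate y ^ 2) ^ 4 by ring, show wallRate y ^ 10 = (wallRate y ^ 2) ^ 5 by ring,
    show wallRate y ^ 12 = (wallRate y ^ 2) ^ 6 by ring] at key
  set B : ℝ := wallRate y ^ 2 with hB
  have hBpos : 0 < B := pow_pos hβ 2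
  set Y : ℝ := y ^ 5 with hYdef
  set p : ℝ := y ^ 3 + y ^ 2 + 2 * y + C with hpdef
  set D : ℝ := Y + p with hD
  have hY : 0 < Y := pow_pos hy 5
  have hp : 0 ≤ p := by positivity
  have hDpos : 0 < D := by positivity
  have hBU : B ≤ D / y ^ 4 := by
    have e : D / y ^ 4 = y + 1 / y + 1 / y ^ 2 + 2 / y ^ 3 + C / y ^ 4 := by
      rw [hD, hYdef, hpdef]; field_simp; ring
    rw [e]; exact hup
  have hBk : ∀ k : ℕ, B ^ k * y ^ (4 * k) ≤ D ^ k := fun k => by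
    have h := pow_le_pow_left₀ hBpos.le hBU k
    rw [div_pow, le_div_iff₀ (pow_pos (pow_pos hy 4) k), ← pow_mul y 4 k] at h
    exact h
  obtain ⟨b2, b3, b4, b5⟩ := bernoulli_inv_aux hY.le hp
  have b6 := bernoulli_inv_six hY.le hp
  -- monotonicity in `B ≤ D/y⁴`
  have m2 : y ^ 9 / D ^ 2 ≤ y / B ^ 2 := by
    rw [div_le_div_iff₀ (pow_pos hDpos 2) (pow_pos hBpos 2)]
    have h := mul_le_mul_of_nonneg_left (hBk 2) hy.le
    calc y ^ 9 * B ^ 2 = y * (B ^ 2 * y ^ (4 * 2)) := by ring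
      _ ≤ y * D ^ 2 := h
  have m3 : y ^ 13 / D ^ 3 ≤ y / B ^ 3 := by
    rw [div_le_div_iff₀ (pow_pos hDpos 3) (pow_pos hBpos 3)]
    have h := mul_le_mul_of_nonneg_left (hBk 3) hy.le
    calc y ^ 13 * B ^ 3 = y * (B ^ 3 * y ^ (4 * 3)) := by ring
      _ ≤ y * D ^ 3 := h
  have m4 : y ^ 17 / D ^ 4 ≤ y / B ^ 4 := by
    rw [div_le_div_iff₀ (pow_pos hDpos 4) (pow_pos hBpos 4)]
    have h := mul_le_mul_of_nonneg_left (hBk 4) hy.le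
    calc y ^ 17 * B ^ 4 = y * (B ^ 4 * y ^ (4 * 4)) := by ring
      _ ≤ y * D ^ 4 := h
  have m5 : y ^ 22 / D ^ 5 ≤ y ^ 2 / B ^ 5 := by
    rw [div_le_div_iff₀ (pow_pos hDpos 5) (pow_pos hBpos 5)]
    have h := mul_le_mul_of_nonneg_left (hBk 5) (pow_pos hy 2).le
    calc y ^ 22 * B ^ 5 = y ^ 2 * (B ^ 5 * y ^ (4 * 5)) := by ring
      _ ≤ y ^ 2 * D ^ 5 := h
  have m6 : y ^ 26 / D ^ 6 ≤ y ^ 2 / B ^ 6 := by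
    rw [div_le_div_iff₀ (pow_pos hDpos 6) (pow_pos hBpos 6)]
    have h := mul_le_mul_of_nonneg_left (hBk 6) (pow_pos hy 2).le
    calc y ^ 26 * B ^ 6 = y ^ 2 * (B ^ 6 * y ^ (4 * 6)) := by ring
      _ ≤ y ^ 2 * D ^ 6 := h
  -- Bernoulli
  have l2 : (Y - 2 * p) / y ^ 6 ≤ y ^ 9 / D ^ 2 := by
    rw [div_le_div_iff₀ (pow_pos hy 6) (pow_pos hDpos 2)]
    calc (Y - 2 * p) * D ^ 2 = (Y - 2 * p) * (Y + p) ^ 2 := by rw [hD]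
      _ ≤ Y ^ 3 := b2
      _ = y ^ 9 * y ^ 6 := by rw [hYdef]; ring
  have l3 : (Y - 3 * p) / y ^ 7 ≤ y ^ 13 / D ^ 3 := by
    rw [div_le_div_iff₀ (pow_pos hy 7) (pow_pos hDpos 3)]
    calc (Y - 3 * p) * D ^ 3 = (Y - 3 * p) * (Y + p) ^ 3 := by rw [hD]
      _ ≤ Y ^ 4 := b3
      _ = y ^ 13 * y ^ 7 := by rw [hYdef]; ring
  have l4 : (Y - 4 * p) / y ^ 8 ≤ y ^ 17 / D ^ 4 := by
    rw [div_le_div_iff₀ (pow_pos hy 8) (pow_pos hDpos 4)]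
    calc (Y - 4 * p) * D ^ 4 = (Y - 4 * p) * (Y + p) ^ 4 := by rw [hD]
      _ ≤ Y ^ 5 := b4
      _ = y ^ 17 * y ^ 8 := by rw [hYdef]; ring
  have l5 : (Y - 5 * p) / y ^ 8 ≤ y ^ 22 / D ^ 5 := by
    rw [div_le_div_iff₀ (pow_pos hy 8) (pow_pos hDpos 5)]
    calc (Y - 5 * p) * D ^ 5 = (Y - 5 * p) * (Y + p) ^ 5 := by rw [hD]
      _ ≤ Y ^ 6 := b5
      _ = y ^ 22 * y ^ 8 := by rw [hYdef]; ring
  have l6 : (Y - 6 * p) / y ^ 9 ≤ y ^ 26 / D ^ 6 := by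
    rw [div_le_div_iff₀ (pow_pos hy 9) (pow_pos hDpos 6)]
    calc (Y - 6 * p) * D ^ 6 = (Y - 6 * p) * (Y + p) ^ 6 := by rw [hD]
      _ ≤ Y ^ 7 := b6
      _ = y ^ 26 * y ^ 9 := by rw [hYdef]; ring
  have e : y + 1 / y + 1 / y ^ 2 + 2 / y ^ 3 + 4 / y ^ 4 - 24 / y ^ 5 - (77 + 2 * C) / y ^ 6 - (88 + 3 * C) / y ^ 7 -
      (108 + 17 * C) / y ^ 8 - 54 * C / y ^ 9 =
      y + (Y - 2 * p) / y ^ 6 + (Y - 3 * p) / y ^ 7 + 3 * ((Y - 4 * p) / y ^ 8) + (Y - 5 * p) / y ^ 8 + 9 * ((Y - 6 * p) / y ^ 9) := by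
    rw [hYdef, hpdef]; field_simp; ring
  have e3 : 3 * y / B ^ 4 = 3 * (y / B ^ 4) := by ring
  have e9 : 9 * y ^ 2 / B ^ 6 = 9 * (y ^ 2 / B ^ 6) := by ring
  rw [e3, e9] at key
  rw [e]
  linarith

/-- ★★★ **The coarse form** (`y ≥ 1`): under `β(y)² ≤ y + 1/y + 1/y² + 2/y³ + C/y⁴`,
`y + 1/y + 1/y² + 2/y³ + 4/y⁴ − (297 + 76C)/y⁵ ≤ β(y)²`. [cite: JansevanRensburg2000, §3.3.2, Lemma 3.20] [cite: BeatonBousquetMelouDeGierDuminilCopinGuttmann2014, §3.1, Proposition 5 (arXiv v5 p. 9); p. 10 (first-order remark)] -/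
theorem fifth_window_lower' (hy : 1 ≤ y) {C : ℝ} (hC : 0 ≤ C) (hup : wallRate y ^ 2 ≤ y + 1 / y + 1 / y ^ 2 + 2 / y ^ 3 + C / y ^ 4) :
    y + 1 / y + 1 / y ^ 2 + 2 / y ^ 3 + 4 / y ^ 4 - (297 + 76 * C) / y ^ 5 ≤ wallRate y ^ 2 := by
  have hy0 : 0 < y := by linarith
  have h := fifth_window_lower hy0 hC hup
  have p6 : y ^ 5 ≤ y ^ 6 := pow_le_pow_right₀ hy (by norm_num)
  have p7 : y ^ 5 ≤ y ^ 7 := pow_le_pow_right₀ hy (by norm_num)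
  have p8 : y ^ 5 ≤ y ^ 8 := pow_le_pow_right₀ hy (by norm_num)
  have p9 : y ^ 5 ≤ y ^ 9 := pow_le_pow_right₀ hy (by norm_num)
  have h6 : (77 + 2 * C) / y ^ 6 ≤ (77 + 2 * C) / y ^ 5 := div_le_div_of_nonneg_left (by positivity) (pow_pos hy0 5) p6
  have h7 : (88 + 3 * C) / y ^ 7 ≤ (88 + 3 * C) / y ^ 5 := div_le_div_of_nonneg_left (by positivity) (pow_pos hy0 5) p7
  have h8 : (108 + 17 * C) / y ^ 8 ≤ (108 + 17 * C) / y ^ 5 := div_le_div_of_nonneg_left (by positivity) (pow_pos hy0 5) p8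
  have h9 : 54 * C / y ^ 9 ≤ 54 * C / y ^ 5 := div_le_div_of_nonneg_left (by positivity) (pow_pos hy0 5) p9
  have e : (297 + 76 * C) / y ^ 5 = 24 / y ^ 5 + (77 + 2 * C) / y ^ 5 + (88 + 3 * C) / y ^ 5 + (108 + 17 * C) / y ^ 5 + 54 * C / y ^ 5 := by
    field_simp; ring
  rw [e]
  linarith

/-- ★★★ **`4 − (297 + 76C)/y ≤ y⁴ (β(y)² − y − 1/y − 1/y² − 2/y³)`** under the fourth-order upper window (`y ≥ 1`): with the companion
«WALL-FOURTH-ORDER-UPPER» (`C = 708591`, `y ≥ 36`) this is `liminf_{y→∞} y⁴ (β² − y − 1/y − 1/y² − 2/y³) ≥ 4`.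
[cite: JansevanRensburg2000, §3.3.2, Lemma 3.20] [cite: BeatonBousquetMelouDeGierDuminilCopinGuttmann2014, §3.1 (arXiv v5 p. 10: first-order remark)] -/
theorem four_sub_div_le_of_window (hy : 1 ≤ y) {C : ℝ} (hC : 0 ≤ C) (hup : wallRate y ^ 2 ≤ y + 1 / y + 1 / y ^ 2 + 2 / y ^ 3 + C / y ^ 4) :
    4 - (297 + 76 * C) / y ≤ y ^ 4 * (wallRate y ^ 2 - y - 1 / y - 1 / y ^ 2 - 2 / y ^ 3) := by
  have hy0 : 0 < y := by linarith
  have h := fifth_window_lower' hy hC hup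
  have e : y ^ 4 * (wallRate y ^ 2 - y - 1 / y - 1 / y ^ 2 - 2 / y ^ 3) =
      y ^ 4 * (wallRate y ^ 2 - (y + 1 / y + 1 / y ^ 2 + 2 / y ^ 3 + 4 / y ^ 4 - (297 + 76 * C) / y ^ 5)) + (4 - (297 + 76 * C) / y) := by
    field_simp
    ring
  rw [e]
  have : 0 ≤ y ^ 4 * (wallRate y ^ 2 - (y + 1 / y + 1 / y ^ 2 + 2 / y ^ 3 + 4 / y ^ 4 - (297 + 76 * C) / y ^ 5)) :=
    mul_nonneg (pow_nonneg hy0.le 4) (by linarith)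
  linarith

/-- The `μ(y)` form of the conditional fifth-order lower bound. [cite: BeatonBousquetMelouDeGierDuminilCopinGuttmann2014, §3.1, Proposition 5 (arXiv v5 p. 9); p. 10 (first-order remark)] [cite: JansevanRensburg2000, §3.3.2, Lemma 3.20] -/
theorem four_sub_div_le_of_window_surfaceMu (hy : 1 ≤ y) {C : ℝ} (hC : 0 ≤ C)
    (hup : HV.surfaceMu y ^ 2 ≤ y + 1 / y + 1 / y ^ 2 + 2 / y ^ 3 + C / y ^ 4) :
    4 - (297 + 76 * C) / y ≤ y ^ 4 * (HV.surfaceMu y ^ 2 - y - 1 / y - 1 / y ^ 2 - 2 / y ^ 3) := by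
  rw [← HV.wallRate_eq_surfaceMu (by linarith)] at hup ⊢
  exact four_sub_div_le_of_window hy hC hup

end Literature.Probability.RandomPlanarGeometry.SAW.HexBW.Wall
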